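import Literature.AlgebraicGeometry.Resolution.EmbeddedCurvePointBlowups
import Literature.AlgebraicGeometry.Resolution.PointBlowupIntersectionMultiplicity
import Literature.AlgebraicGeometry.Resolution.StrictNormalCrossingsAt
import Literature.AlgebraicGeometry.Resolution.PrimeDivisorIdeals
import Literature.AlgebraicGeometry.Resolution.ExceptionalDivisorRegularGlobal
import Literature.AlgebraicGeometry.Resolution.BlowupExceptionalFibreIrreducible
import Literature.AlgebraicGeometry.Resolution.BlowupAxialDivisor
import Literature.AlgebraicGeometry.Resolution.BlowupDimension
import Literature.AlgebraicGeometry.Resolution.QuasiExcellentBlowup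
import Literature.AlgebraicGeometry.Resolution.PermissibleCentres
import Literature.AlgebraicGeometry.Resolution.CartierDivisorControlledTransformReduced
import Literature.AlgebraicGeometry.Resolution.StrictTransformSupport
import Literature.AlgebraicGeometry.Resolution.StalkIdealLemmas
import Literature.AlgebraicGeometry.Resolution.NormalCrossingsBlowupStepReductionProofs
import Literature.AlgebraicGeometry.Resolution.ComponentGluing
import HarnessLib

/-!
# Crux `PatchingRelPerfect` (stmt-ResolutionOfSingularities-16161), chain W5.2 — (M2b-S′) LOCAL CURVE-CONFIGURATION ENGINE,
# module M1′a: one blowing up at a closed point of a regular surface — the new surface, the exceptional curve, the lifted branches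

[OURS · L1 W5.2 · F7(β) (β-AX) X3 C-I (M2b-S′) · module M1′ of `D/res-D-pv-034/CurveConfig-PLAN.md` (res-D-pv-001, custody
DEAL #76).]  Replaces the role of NO printed item; NOT a statement of the manuscript under review; fact-free, def-free.
AI-written; AI review is weaker than expert review.

Currency of the engine (plan, «likely refinements»): the ambient `Y` is an INTEGRAL locally Noetherian scheme all of whose
local rings are regular; a BRANCH is a point `ζ` of codimension one (`Order.coheight ζ = 1`), i.e. the prime divisor
`cl{ζ}` with its reduced ideal sheaf `primeDivisorIdeal ζ` (`PrimeDivisorIdeals.lean`); a branch passes through `p` iff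
`ζ ⤳ p`, and its germ at `p` is the height-one prime `primeOfSpecializes (ζ ⤳ p) = (primeDivisorIdeal ζ)_p` of `𝒪_{Y,p}`.

This file, for the blowing up `τ : Y₁ → Y` (universal property, `IsBlowup`) at a closed point `p`:
* `isRegular_subscheme_vanishingIdeal_singleton` — the reduced point `{p}` is a regular closed subscheme;
  `maximalIdeal_ne_bot_of_specializes` — `𝔪_p ≠ 0` as soon as a point `ζ ≠ p` specialises to `p`;
* (a) `Y₁` is integral, locally Noetherian, regular, quasi-excellent if `Y` is, of dimension `≤ dim Y`
  (`blowupPoint_isIntegral`, `…_isLocallyNoetherian`, `…_isRegular`, `…_isQuasiExcellent`, `…_topologicalKrullDim_le`);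
* (b) the exceptional curve `E = τ⁻¹ p`: `𝓘_p·𝒪_{Y₁} = 𝓘_E` (`blowupPoint_comap_eq_vanishingIdeal_preimage`), `E` is irreducible
  (`blowupPoint_isIrreducible_preimage`); for a point `ζ_E` with `cl{ζ_E} = τ⁻¹ p`: `dim 𝒪_{Y₁,ζ_E} = 1` and `coheight ζ_E = 1`
  (`blowupPoint_ringKrullDim_stalk_eq_one_of_closure_eq`, `blowupPoint_coheight_eq_one_of_closure_eq`), and at every point `q`
  of `E` the germ `(𝓘_E)_q` is generated by ONE regular parameter (`blowupPoint_exists_rsop_stalkIdeal_exceptional`);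
* (c) a point `y ≠ p` has exactly one point `y₁` over it, with `𝒪_{Y,y} ≅ 𝒪_{Y₁,y₁}` and the same codimension
  (`blowupPoint_existsUnique_preimage`, `blowupPoint_isIso_stalkMap_of_ne`, `blowupPoint_coheight_eq_of_ne`).

## References
* The Stacks Project, Tags 0BI7, 0BIC (embedded resolution in surfaces), 02OS. [StacksProject]
* Q. Liu, *Algebraic Geometry and Arithmetic Curves* (2002), Thm. 8.1.19, Lemma 9.2.32. [Liu2002]
-/

-- `Summit.<Summit>.<Sub>.Theorems` with `Sub = Summit` (single-conjunct summit, D-0017)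
set_option linter.dupNamespace false

noncomputable section

open CategoryTheory AlgebraicGeometry TopologicalSpace IsLocalRing
open Literature.AlgebraicGeometry.Resolution
open Scheme.IdealSheafData

namespace Summit.ResolutionOfSingularities.ResolutionOfSingularities.Theorems.CurveConfig

universe u

variable {Y Y₁ : Scheme.{u}}

/-! ## The reduced closed point -/

/-- The ideal sheaf of a closed point `p` has support `{p}`. [folklore] -/
theorem coe_support_vanishingIdeal_singleton {p : Y} (hp : IsClosed ({p} : Set Y)) :
    ((vanishingIdeal ⟨{p}, hp⟩).support : Set Y) = {p} :=
  Scheme.IdealSheafData.coe_support_vanishingIdeal _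

/-- **The reduced closed point is a regular closed subscheme**: its only local ring is the residue field
`𝒪_{Y,p}/𝔪_p`. [folklore] -/
theorem isRegular_subscheme_vanishingIdeal_singleton [IsLocallyNoetherian Y] {p : Y}
    (hp : IsClosed ({p} : Set Y)) : Scheme.IsRegular (vanishingIdeal ⟨{p}, hp⟩).subscheme := by
  refine Scheme.isRegular_subscheme_of_forall _ fun x hx => ?_
  have hx' : x = p := by
    have h : x ∈ ((vanishingIdeal ⟨{p}, hp⟩).support : Set Y) := hx
    rw [coe_support_vanishingIdeal_singleton hp] at h
    exact h
  subst hx'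
  rw [stalkIdeal_vanishingIdeal_singleton hp]
  letI : Field (Y.presheaf.stalk x ⧸ maximalIdeal (Y.presheaf.stalk x)) := Ideal.Quotient.field _
  infer_instance

/-- A closed point with a proper generization is not the whole space: `{p} ≠ univ`. [folklore] -/
theorem singleton_ne_univ_of_ne {p ζ : Y} (hne : ζ ≠ p) : ({p} : Set Y) ≠ Set.univ := by
  intro h
  have : ζ ∈ ({p} : Set Y) := h ▸ Set.mem_univ ζ
  exact hne this

/-- For `ζ ⤳ p`, `ζ ≠ p` with `p` closed: `p < ζ` in the specialisation order of `Y`. [folklore] -/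
theorem lt_of_specializes_of_ne {p ζ : Y} (hp : IsClosed ({p} : Set Y)) (hζp : ζ ⤳ p) (hne : ζ ≠ p) : p < ζ := by
  refine lt_iff_le_not_ge.mpr ⟨Scheme.le_iff_specializes.mpr hζp, fun h => hne ?_⟩
  have hpζ : p ⤳ ζ := Scheme.le_iff_specializes.mp h
  have : ζ ∈ closure ({p} : Set Y) := specializes_iff_mem_closure.mp hpζ
  rwa [hp.closure_eq] at this

/-- **`coheight p ≥ coheight ζ + 1`** for a proper generization `ζ ⤳ p` of a closed point. [folklore] -/
theorem coheight_add_one_le_of_specializes {p ζ : Y} (hp : IsClosed ({p} : Set Y)) (hζp : ζ ⤳ p) (hne : ζ ≠ p) :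
    Order.coheight ζ + 1 ≤ Order.coheight p :=
  Order.coheight_add_one_le (lt_of_specializes_of_ne hp hζp hne)

/-- At a closed point `p` with a proper generization `ζ ⤳ p`, `ζ ≠ p`, the maximal ideal `𝔪_p` is non-zero
(`dim 𝒪_{Y,p} = coheight p ≥ 1`). [folklore] -/
theorem maximalIdeal_ne_bot_of_specializes {p ζ : Y} (hp : IsClosed ({p} : Set Y))
    (hζp : ζ ⤳ p) (hne : ζ ≠ p) : maximalIdeal (Y.presheaf.stalk p) ≠ ⊥ := by
  intro h
  have hfield : IsField (Y.presheaf.stalk p) := IsLocalRing.isField_iff_maximalIdeal_eq.mpr h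
  have hdim : ringKrullDim (Y.presheaf.stalk p) = 0 := ringKrullDim_eq_zero_of_isField hfield
  rw [ringKrullDim_stalk_eq_coheight] at hdim
  have h0 : Order.coheight p = 0 := by exact_mod_cast hdim
  have := coheight_add_one_le_of_specializes hp hζp hne
  rw [h0] at this
  exact absurd this (by simp)

/-! ## (a) The blown-up surface -/

section Ambient

variable {p : Y} (hp : IsClosed ({p} : Set Y)) {τ : Y₁ ⟶ Y} (hτ : IsBlowup τ (vanishingIdeal ⟨{p}, hp⟩))

include hτ in
/-- The blowing up of an integral scheme at a proper closed point is integral. [cite: StacksProject, Tag 02ND] -/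
theorem blowupPoint_isIntegral [IsIntegral Y] (hpne : ({p} : Set Y) ≠ Set.univ) : IsIntegral Y₁ :=
  hτ.isIntegral (vanishingIdeal_singleton_ne_bot hp hpne)

include hτ in
/-- The blowing up of a locally Noetherian scheme at a closed point is locally Noetherian. [folklore] -/
theorem blowupPoint_isLocallyNoetherian [IsLocallyNoetherian Y] : IsLocallyNoetherian Y₁ :=
  haveI := hτ.isProper
  LocallyOfFiniteType.isLocallyNoetherian τ

include hτ in
/-- **The blowing up of a regular scheme at a closed point is regular** (Liu, Thm. 8.1.19 (a), tree
`IsBlowup.isRegular_of_isRegular_subscheme`). [cite: Liu2002, Thm. 8.1.19 (a)] -/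
theorem blowupPoint_isRegular [IsLocallyNoetherian Y] (hreg : Scheme.IsRegular Y) : Scheme.IsRegular Y₁ :=
  hτ.isRegular_of_isRegular_subscheme hreg (isRegular_subscheme_vanishingIdeal_singleton hp)

include hτ in
/-- The blowing up of a quasi-excellent scheme at a closed point is quasi-excellent. [cite: StacksProject, Tag 07QU] -/
theorem blowupPoint_isQuasiExcellent [IsLocallyNoetherian Y] (hqe : Scheme.IsQuasiExcellent Y) :
    Scheme.IsQuasiExcellent Y₁ :=
  hτ.isQuasiExcellent hqe

include hτ in
/-- Blowing up does not raise the dimension. [cite: Matsumura1987, Thm. 15.5] -/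
theorem blowupPoint_topologicalKrullDim_le [IsIntegral Y] [IsLocallyNoetherian Y] {n : ℕ}
    (hdim : topologicalKrullDim Y ≤ n) : topologicalKrullDim Y₁ ≤ n :=
  hτ.topologicalKrullDim_le hdim

include hτ in
/-- Blowing up does not raise codimensions of points. [cite: Matsumura1987, Thm. 15.5] -/
theorem blowupPoint_coheight_le [IsIntegral Y] [IsLocallyNoetherian Y] (y : Y₁) :
    Order.coheight y ≤ Order.coheight (τ y) :=
  hτ.coheight_le y

end Ambient

/-! ## (b) The exceptional curve `E = τ⁻¹ p` -/

/-- The exceptional curve `τ⁻¹ p` is a closed subset of `Y₁`. [folklore] -/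
theorem isClosed_preimage_singleton {p : Y} (hp : IsClosed ({p} : Set Y)) (τ : Y₁ ⟶ Y) :
    IsClosed (τ ⁻¹' ({p} : Set Y)) :=
  hp.preimage τ.continuous

/-- A local domain whose maximal ideal is principal, generated by a non-zero element, has dimension one. [folklore] -/
theorem ringKrullDim_eq_one_of_maximalIdeal_eq_span {A : Type u} [CommRing A] [IsLocalRing A] [IsDomain A]
    [IsNoetherianRing A] {t : A} (ht : maximalIdeal A = Ideal.span {t}) (ht0 : t ≠ 0) : ringKrullDim A = 1 := by
  have hne : maximalIdeal A ≠ ⊥ := by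
    rw [ht, Ne, Ideal.span_singleton_eq_bot]
    exact ht0
  haveI : (maximalIdeal A).IsPrincipal := ⟨t, by rw [ht]⟩
  have h1 : ringKrullDim A ≤ 1 := by
    rw [← IsLocalRing.maximalIdeal_height_eq_ringKrullDim]
    have hmin : maximalIdeal A ∈ (maximalIdeal A).minimalPrimes := by
      rw [Ideal.minimalPrimes_eq_subsingleton_self]; exact Set.mem_singleton _
    exact_mod_cast Ideal.height_le_one_of_isPrincipal_of_mem_minimalPrimes _ _ hmin
  have h0 : ¬ ringKrullDim A ≤ 0 := fun h => by
    haveI : Ring.KrullDimLE 0 A := Ring.krullDimLE_iff.mpr h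
    exact hne (IsLocalRing.isField_iff_maximalIdeal_eq.mp Ring.KrullDimLE.isField_of_isDomain)
  exact le_antisymm h1 (Order.succ_le_of_lt (lt_of_not_ge h0))

section Exceptional

variable [IsIntegral Y] [IsLocallyNoetherian Y] (hreg : Scheme.IsRegular Y) {p : Y} (hp : IsClosed ({p} : Set Y))
  {τ : Y₁ ⟶ Y} (hτ : IsBlowup τ (vanishingIdeal ⟨{p}, hp⟩))

include hreg hτ in
omit [IsIntegral Y] in
/-- **`𝓘_p · 𝒪_{Y₁} = 𝓘_E`**: the inverse image ideal sheaf of the reduced point is the reduced ideal sheaf of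
the exceptional curve `E = τ⁻¹ p` (Liu 8.1.19 (b): the exceptional divisor of a regular blow-up is regular, hence
reduced). [cite: Liu2002, Thm. 8.1.19 (b)] -/
theorem blowupPoint_comap_eq_vanishingIdeal_preimage :
    (vanishingIdeal ⟨{p}, hp⟩).comap τ = vanishingIdeal ⟨τ ⁻¹' {p}, isClosed_preimage_singleton hp τ⟩ :=
  hτ.comap_vanishingIdeal_eq_vanishingIdeal_preimage hreg (isRegular_subscheme_vanishingIdeal_singleton hp)

include hreg hτ in
omit [IsIntegral Y] in
/-- The support of `𝓘_p · 𝒪_{Y₁}` is `τ⁻¹ p`. [folklore] -/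
theorem blowupPoint_coe_support_comap :
    (((vanishingIdeal ⟨{p}, hp⟩).comap τ).support : Set Y₁) = τ ⁻¹' {p} := by
  rw [blowupPoint_comap_eq_vanishingIdeal_preimage hreg hp hτ, Scheme.IdealSheafData.coe_support_vanishingIdeal]
  rfl

include hreg hτ in
omit [IsIntegral Y] [IsLocallyNoetherian Y] in
/-- **The exceptional curve is irreducible** (it is `ℙ¹_{κ(p)}`; tree `IsBlowup.isIrreducible_preimage_singleton`),
provided `𝔪_p ≠ 0`. [cite: Hartshorne1977, II Thm. 8.24 (b)] -/
theorem blowupPoint_isIrreducible_preimage (hm : maximalIdeal (Y.presheaf.stalk p) ≠ ⊥) :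
    IsIrreducible (τ ⁻¹' ({p} : Set Y)) := by
  haveI : IsRegularLocalRing (Y.presheaf.stalk p) := hreg p
  exact hτ.isIrreducible_preimage_singleton p (stalkIdeal_vanishingIdeal_singleton hp) hm

include hreg hτ in
omit [IsIntegral Y] in
/-- For a point `ζ_E` with `cl{ζ_E} = τ⁻¹ p`: `𝓘_p·𝒪_{Y₁} = primeDivisorIdeal ζ_E`. [cite: Liu2002, Thm. 8.1.19 (b)] -/
theorem blowupPoint_comap_eq_primeDivisorIdeal {ζE : Y₁} (hζE : closure ({ζE} : Set Y₁) = τ ⁻¹' {p}) :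
    (vanishingIdeal ⟨{p}, hp⟩).comap τ = primeDivisorIdeal ζE := by
  rw [blowupPoint_comap_eq_vanishingIdeal_preimage hreg hp hτ, primeDivisorIdeal]
  congr 1
  exact Closeds.ext hζE.symm

include hreg hτ in
/-- **The local ring of `Y₁` at a generic point `ζ_E` of the exceptional curve has dimension one**: its maximal
ideal is the stalk `(𝓘_E)_{ζ_E} = (𝓘_p·𝒪_{Y₁})_{ζ_E}`, an invertible ideal, hence principal and non-zero.
[cite: Liu2002, Thm. 8.1.19 (b)] -/
theorem blowupPoint_ringKrullDim_stalk_eq_one_of_closure_eq (hpne : ({p} : Set Y) ≠ Set.univ) {ζE : Y₁}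
    (hζE : closure ({ζE} : Set Y₁) = τ ⁻¹' {p}) : ringKrullDim (Y₁.presheaf.stalk ζE) = 1 := by
  haveI : IsIntegral Y₁ := blowupPoint_isIntegral hp hτ hpne
  haveI : IsLocallyNoetherian Y₁ := blowupPoint_isLocallyNoetherian hp hτ
  have hmax : stalkIdeal ((vanishingIdeal ⟨{p}, hp⟩).comap τ) ζE = maximalIdeal (Y₁.presheaf.stalk ζE) := by
    rw [blowupPoint_comap_eq_primeDivisorIdeal hreg hp hτ hζE, stalkIdeal_primeDivisorIdeal_self]
  obtain ⟨t, ht0, ht⟩ := hτ.isEffectiveCartier.exists_stalkIdeal_eq_span ζE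
  rw [hmax] at ht
  exact ringKrullDim_eq_one_of_maximalIdeal_eq_span ht (nonZeroDivisors.ne_zero ht0)

include hreg hτ in
/-- **The exceptional curve is a prime divisor**: a point `ζ_E` with `cl{ζ_E} = τ⁻¹ p` has codimension one in `Y₁`.
[cite: Liu2002, Thm. 8.1.19 (b)] -/
theorem blowupPoint_coheight_eq_one_of_closure_eq (hpne : ({p} : Set Y) ≠ Set.univ) {ζE : Y₁}
    (hζE : closure ({ζE} : Set Y₁) = τ ⁻¹' {p}) : Order.coheight ζE = 1 := by
  have h := blowupPoint_ringKrullDim_stalk_eq_one_of_closure_eq hreg hp hτ hpne hζE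
  rw [ringKrullDim_stalk_eq_coheight] at h
  exact_mod_cast h

include hreg in
omit [IsIntegral Y] [IsLocallyNoetherian Y] in
/-- At the closed point `p` of the regular scheme `Y`, `(𝓘_p)_p = 𝔪_p` is generated by a regular system of parameters
(the centre datum consumed by `IsBlowup.exists_rsop_stalkIdeal_primeDivisorIdeal`). [folklore] -/
theorem exists_isRsopPart_stalkIdeal_vanishingIdeal_singleton :
    ∀ x ∈ (⟨{p}, hp⟩ : Closeds Y), ∃ (k : ℕ) (c : Fin k → Y.presheaf.stalk x),
      IsRsopPart c ∧ stalkIdeal (vanishingIdeal ⟨{p}, hp⟩) x = Ideal.span (Set.range c) := by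
  intro x hx
  have hx' : x = p := hx
  subst hx'
  haveI : IsRegularLocalRing (Y.presheaf.stalk x) := hreg x
  -- a regular system of parameters of `𝒪_{Y,p}` (the complement of the empty part)
  obtain ⟨hR, e, y, hd, hy⟩ := isRsopPart_of_isRegularLocalRing_zero (R := Y.presheaf.stalk x) Fin.elim0
  rw [Set.range_eq_empty (Fin.elim0 : Fin 0 → _), Set.empty_union] at hy
  refine ⟨e, y, ⟨hR, 0, Fin.elim0, ?_, ?_⟩, ?_⟩
  · rw [hd]; simp
  · rw [Set.range_eq_empty (Fin.elim0 : Fin 0 → _), Set.union_empty]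
    exact hy
  · rw [stalkIdeal_vanishingIdeal_singleton hp, ← hy]

include hreg hτ in
/-- **At every point `q` of the exceptional curve the germ `(𝓘_E)_q` is generated by a regular parameter `t` of
`𝒪_{Y₁,q}`** (tree `IsBlowup.exists_rsop_stalkIdeal_primeDivisorIdeal`; in particular `𝒪_{Y₁,q}/(t)` is regular:
the exceptional curve is regular). [cite: DeJong1996, 2.4] [cite: Liu2002, Thm. 8.1.19 (b)] -/
theorem blowupPoint_exists_rsop_stalkIdeal_exceptional (hpne : ({p} : Set Y) ≠ Set.univ) {ζE : Y₁}
    (hζE : closure ({ζE} : Set Y₁) = τ ⁻¹' {p}) {q : Y₁} (hq : ζE ⤳ q) :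
    ∃ t : Y₁.presheaf.stalk q, IsRsopPart ![t] ∧ stalkIdeal (primeDivisorIdeal ζE) q = Ideal.span {t} := by
  haveI : IsLocallyNoetherian Y₁ := blowupPoint_isLocallyNoetherian hp hτ
  have hζ : τ ζE ∈ (⟨{p}, hp⟩ : Closeds Y) := by
    change ζE ∈ τ ⁻¹' {p}
    rw [← hζE]; exact subset_closure rfl
  exact hτ.exists_rsop_stalkIdeal_primeDivisorIdeal (exists_isRsopPart_stalkIdeal_vanishingIdeal_singleton hreg hp) hζ
    (blowupPoint_ringKrullDim_stalk_eq_one_of_closure_eq hreg hp hτ hpne hζE) hq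

omit [IsIntegral Y] [IsLocallyNoetherian Y] in
/-- The points of the exceptional curve are the specialisations of `ζ_E`. [folklore] -/
theorem blowupPoint_mem_preimage_iff_specializes {ζE : Y₁} (hζE : closure ({ζE} : Set Y₁) = τ ⁻¹' {p}) (q : Y₁) :
    τ q = p ↔ ζE ⤳ q := by
  rw [specializes_iff_mem_closure, hζE]
  rfl

end Exceptional

/-! ## (c) Points off the centre -/

section OffCentre

variable {p : Y} (hp : IsClosed ({p} : Set Y)) {τ : Y₁ ⟶ Y} (hτ : IsBlowup τ (vanishingIdeal ⟨{p}, hp⟩))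

include hτ in
/-- **Off `p` every point has exactly one preimage** (the blowing up is an isomorphism over `Y ∖ {p}`).
[cite: StacksProject, Tag 02OS] -/
theorem blowupPoint_existsUnique_preimage {y : Y} (hy : y ≠ p) : ∃! y₁ : Y₁, τ y₁ = y :=
  hτ.existsUnique_preimage_of_ne (coe_support_vanishingIdeal_singleton hp) hy

include hτ in
/-- Off `p` the stalk maps of the blowing up are isomorphisms. [cite: StacksProject, Tag 02OS] -/
theorem blowupPoint_isIso_stalkMap_of_ne {y₁ : Y₁} (hy : τ y₁ ≠ p) : IsIso (τ.stalkMap y₁) :=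
  hτ.isIso_stalkMap_of_not_mem hp (coe_support_vanishingIdeal_singleton hp) hy

include hτ in
/-- Off `p` the blowing up preserves codimension. [cite: StacksProject, Tag 02OS] -/
theorem blowupPoint_coheight_eq_of_ne {y₁ : Y₁} (hy : τ y₁ ≠ p) : Order.coheight y₁ = Order.coheight (τ y₁) := by
  refine (hτ.coheight_eq_of_not_mem ?_).symm
  rw [coe_support_vanishingIdeal_singleton hp]
  exact hy

include hτ in
/-- **Off `p` the strict normal crossings condition lifts**: for a closed `A ⊆ Y` with strict normal crossings at
`τ y₁ ≠ p`, `τ⁻¹ A` has strict normal crossings at `y₁`. [folklore] -/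
theorem blowupPoint_isStrictNormalCrossingsAt_preimage_of_ne {A : Set Y} (hA : IsClosed A) {y₁ : Y₁} (hy : τ y₁ ≠ p)
    (h : IsStrictNormalCrossingsAt Y A (τ y₁)) : IsStrictNormalCrossingsAt Y₁ (τ ⁻¹' A) y₁ :=
  hτ.isStrictNormalCrossingsAt_preimage_of_not_mem hp (coe_support_vanishingIdeal_singleton hp) hA hy h

end OffCentre

end Summit.ResolutionOfSingularities.ResolutionOfSingularities.Theorems.CurveConfig

end
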